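import Mathlib
import Summits.NavierStokesRegularity.NavierStokesRegularity.Theorems.ThreadingFluxCentreJetHarmonicTangentRigidity
import HarnessLib

/-!
# Crux `PoloidalLiouville` (stmt-NavierStokesRegularity-1222, wall W1), crux idea «steady-centre-sieve» (ns-idea-15):
# HARMONIC TANGENT FIELDS OF DEGREE TWO ARE POLHODE FIELDS — the `k = 2` case of the algebraic core

Support file (`--supports stmt-NavierStokesRegularity-1222`, helper; cell `ns-wall-extremal`, ns-wall-eng-7 g6, 0 kit).  Companion of
`HarmonicTangent.harmonicTangentRigidity` (file (1) of L1): the same four polynomial facts (tangent, divergence free, harmonic, loop law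
against a triaxial traceless `diag(a)`) in the EXCEPTIONAL degree `k = 2` force the field to be a multiple of the Euler-top (polhode) field
`W = X × SX` (`eulerTopField a`): `eq_smul_eulerTop_of_degree_two`.  This is the card's first step of the POLHODE SIEVE («`T₂ = λ⟪y,Sy⟫`
forced: vortex lines = polhodes», CentreJetSketch, docstring of C1″ `NoTriaxialPolhodeCentre`), as algebra; `exists_toroidalPotential`
records the toroidal representation `q = ∇T × X` (T harmonic, homogeneous, `W·∇T ∝` loop polynomial) for every degree `k ≥ 1`.

HONEST FRAME: algebra about one crux idea's objects; closes no crux or sketch Prop; `PoloidalLiouville` (1222) and NS regularity OPEN.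
-/

-- the summit and its single sub-problem share the name (CONVENTIONS §1)
set_option linter.dupNamespace false

noncomputable section

namespace Summit.NavierStokesRegularity.NavierStokesRegularity.Theorems.PoloidalLiouville.CentreJet.HarmonicTangent

open MvPolynomial
open Summit.NavierStokesRegularity.NavierStokesRegularity.Theorems.PoloidalLiouville.CentreJet

/-- **Toroidal representation of a harmonic tangent divergence-free polynomial field** (degree `n + 1`): `q = ∇T × X` with `T`
homogeneous of degree `n + 1` and harmonic (the construction inside `harmonicTangentRigidity`, recorded as a statement). -/
theorem exists_toroidalPotential {n : ℕ} (q : Fin 3 → MvPolynomial (Fin 3) ℝ) (hhom : ∀ i, (q i).IsHomogeneous (n + 1))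
    (htan : ∑ i : Fin 3, X i * q i = 0) (hdiv : ∑ i : Fin 3, pderiv i (q i) = 0)
    (hharm : ∀ i, ∑ j : Fin 3, pderiv j (pderiv j (q i)) = 0) :
    ∃ T : MvPolynomial (Fin 3) ℝ, T.IsHomogeneous (n + 1) ∧ (∑ i : Fin 3, pderiv i (pderiv i T) = 0) ∧
      q 0 = pderiv 1 T * X 2 - pderiv 2 T * X 1 ∧ q 1 = pderiv 2 T * X 0 - pderiv 0 T * X 2 ∧
      q 2 = pderiv 0 T * X 1 - pderiv 1 T * X 0 := by
  classical
  rw [Fin.sum_univ_three] at htan hdiv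
  have hharm' : ∀ i, pderiv 0 (pderiv 0 (q i)) + pderiv 1 (pderiv 1 (q i)) + pderiv 2 (pderiv 2 (q i)) = 0 :=
    fun i => by have := hharm i; rwa [Fin.sum_univ_three] at this
  set κ0 := pderiv 1 (q 2) - pderiv 2 (q 1) with hκ0
  set κ1 := pderiv 2 (q 0) - pderiv 0 (q 2) with hκ1
  set κ2 := pderiv 0 (q 1) - pderiv 1 (q 0) with hκ2
  have hpd : ∀ i j, (pderiv j (q i)).IsHomogeneous n := fun i j => by
    simpa using (hhom i).pderiv (i := j)
  have hκ0h : κ0.IsHomogeneous n := (hpd 2 1).sub (hpd 1 2)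
  have hκ1h : κ1.IsHomogeneous n := (hpd 0 2).sub (hpd 2 0)
  have hκ2h : κ2.IsHomogeneous n := (hpd 1 0).sub (hpd 0 1)
  have hc0 : pderiv 1 κ2 = pderiv 2 κ1 := curl_curl_zero hdiv hharm'
  have hc1 : pderiv 2 κ0 = pderiv 0 κ2 := curl_curl_one hdiv hharm'
  have hc2 : pderiv 0 κ1 = pderiv 1 κ0 := curl_curl_two hdiv hharm'
  set σ := X 0 * κ0 + X 1 * κ1 + X 2 * κ2 with hσ
  have hσd : ∀ i, pderiv i σ = ((n : MvPolynomial (Fin 3) ℝ) + 1) * ![κ0, κ1, κ2] i :=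
    fun i => pderiv_sigma hκ0h hκ1h hκ2h hc2 hc0 hc1 i
  have hx0 : κ1 * X 2 - κ2 * X 1 = ((n : MvPolynomial (Fin 3) ℝ) + 2) * q 0 := by
    have h := cross_curl_zero hhom htan; push_cast at h; linear_combination h
  have hx1 : κ2 * X 0 - κ0 * X 2 = ((n : MvPolynomial (Fin 3) ℝ) + 2) * q 1 := by
    have h := cross_curl_one hhom htan; push_cast at h; linear_combination h
  have hx2 : κ0 * X 1 - κ1 * X 0 = ((n : MvPolynomial (Fin 3) ℝ) + 2) * q 2 := by
    have h := cross_curl_two hhom htan; push_cast at h; linear_combination h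
  set c : ℝ := (((n : ℝ) + 1) * ((n : ℝ) + 2))⁻¹ with hc
  have hcc : C c * ((n : MvPolynomial (Fin 3) ℝ) + 1) * ((n : MvPolynomial (Fin 3) ℝ) + 2) = 1 := by
    have h1 : C c * ((n : MvPolynomial (Fin 3) ℝ) + 1) * ((n : MvPolynomial (Fin 3) ℝ) + 2) =
        C (c * (((n : ℝ) + 1) * ((n : ℝ) + 2))) := by
      simp only [map_mul, map_add, map_natCast, map_one, map_ofNat]; ring
    rw [h1, hc, inv_mul_cancel₀ (by positivity), map_one]
  set T := C c * σ with hTdef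
  have hTd : ∀ i, pderiv i T = C c * (((n : MvPolynomial (Fin 3) ℝ) + 1) * ![κ0, κ1, κ2] i) := fun i => by
    rw [hTdef, Derivation.leibniz, pderiv_C, smul_zero, add_zero, smul_eq_mul, hσd]
  refine ⟨T, ?_, ?_, ?_, ?_, ?_⟩
  · have hX : ∀ (i : Fin 3) (p : MvPolynomial (Fin 3) ℝ), p.IsHomogeneous n →
        ((X i : MvPolynomial (Fin 3) ℝ) * p).IsHomogeneous (n + 1) := fun i p hp => by
      simpa [add_comm] using (isHomogeneous_X ℝ i).mul hp
    have hσhom : σ.IsHomogeneous (n + 1) := ((hX 0 κ0 hκ0h).add (hX 1 κ1 hκ1h)).add (hX 2 κ2 hκ2h)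
    simpa [hTdef] using hσhom.C_mul c
  · have hC : C c * ((n : MvPolynomial (Fin 3) ℝ) + 1) = C (c * ((n : ℝ) + 1)) := by
      simp only [map_mul, map_add, map_natCast, map_one]
    have h : ∀ i, pderiv i (pderiv i T) = C (c * ((n : ℝ) + 1)) * pderiv i (![κ0, κ1, κ2] i) := fun i => by
      rw [hTd i, ← mul_assoc, hC, Derivation.leibniz, pderiv_C, smul_zero, add_zero, smul_eq_mul]
    rw [Fin.sum_univ_three, h, h, h, ← hC]
    simp only [Matrix.cons_val_zero, Matrix.cons_val_one, Matrix.cons_val_two, Matrix.tail_cons, Matrix.head_cons]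
    have hdc : pderiv 0 κ0 + pderiv 1 κ1 + pderiv 2 κ2 = 0 := div_curl q
    linear_combination (C c * ((n : MvPolynomial (Fin 3) ℝ) + 1)) * hdc
  · rw [hTd, hTd]
    simp only [Matrix.cons_val_one, Matrix.cons_val_zero, Matrix.cons_val_two, Matrix.tail_cons, Matrix.head_cons]
    linear_combination (-(C c * ((n : MvPolynomial (Fin 3) ℝ) + 1))) * hx0 - (q 0) * hcc
  · rw [hTd, hTd]
    simp only [Matrix.cons_val_zero, Matrix.cons_val_two, Matrix.tail_cons, Matrix.head_cons]
    linear_combination (-(C c * ((n : MvPolynomial (Fin 3) ℝ) + 1))) * hx1 - (q 1) * hcc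
  · rw [hTd, hTd]
    simp only [Matrix.cons_val_zero, Matrix.cons_val_one]
    linear_combination (-(C c * ((n : MvPolynomial (Fin 3) ℝ) + 1))) * hx2 - (q 2) * hcc

/-- **Degree two: harmonic tangent fields obeying the loop law are polhode fields.**  If `q` is homogeneous of degree `2`, tangent to the
spheres, divergence free, harmonic, and satisfies the loop law against a triaxial traceless `diag(a)`, then `q = μ · W` with
`W = eulerTopField a = X × SX` (equivalently `q = ∇T × X` with `T = −(μ/2)⟪X, SX⟫`). -/
theorem eq_smul_eulerTop_of_degree_two (a : Fin 3 → ℝ) (ha : Function.Injective a) (hsum : ∑ i, a i = 0)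
    (q : Fin 3 → MvPolynomial (Fin 3) ℝ) (hhom : ∀ i, (q i).IsHomogeneous 2)
    (htan : ∑ i : Fin 3, X i * q i = 0) (hdiv : ∑ i : Fin 3, pderiv i (q i) = 0)
    (hharm : ∀ i, ∑ j : Fin 3, pderiv j (pderiv j (q i)) = 0)
    (hloop : ∑ i : Fin 3, X i * ((∑ j : Fin 3, C (a j) * X j * pderiv j (q i)) - C (a i) * q i) = 0) :
    ∃ μ : ℝ, ∀ i, q i = C μ * eulerTopField a i := by
  classical
  obtain ⟨T, hThom, hTharm, hq0, hq1, hq2⟩ := exists_toroidalPotential (n := 1) q hhom htan hdiv hharm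
  -- the loop law: `T` is a first integral of the Euler top
  have hTL : ∑ i : Fin 3, eulerTopField a i * pderiv i T = 0 := by
    have h := loop_eq_topL a T q hq0 hq1 hq2
    rw [hloop] at h
    have h2 : C (-2 : ℝ) * ∑ i : Fin 3, eulerTopField a i * pderiv i T = 0 := h.symm
    rcases mul_eq_zero.mp h2 with h3 | h3
    · exact absurd (C_eq_zero.mp h3) (by norm_num)
    · exact h3
  -- A1 + A2: `T = c₀ + c₁⟪X,SX⟫`; degree two ⇒ `T = c₁⟪X,SX⟫`
  obtain ⟨F, hF⟩ := eulerTopFirstIntegrals a ha T hTL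
  have hΔF : ∑ i : Fin 3, pderiv i (pderiv i (aeval ![rhoPoly, strainPoly a] F)) = 0 := by rw [← hF]; exact hTharm
  obtain ⟨c₀, c₁, hc⟩ := noHarmonicPolhodeInvariant a ha hsum F hΔF
  have hT' : T = C c₀ + C c₁ * strainPoly a := by
    rw [hF, hc]
    simp
  have hT2 : T = C c₁ * strainPoly a := by
    have h0 : homogeneousComponent 2 (C c₀ : MvPolynomial (Fin 3) ℝ) = 0 := by
      rw [homogeneousComponent_of_mem (isHomogeneous_C (Fin 3) c₀), if_neg (by omega)]
    have h2 : homogeneousComponent 2 (C c₁ * strainPoly a) = C c₁ * strainPoly a := by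
      rw [homogeneousComponent_of_mem ((isHomogeneous_strainPoly a).C_mul c₁), if_pos rfl]
    calc T = homogeneousComponent 2 T := (homogeneousComponent_eq_self hThom).symm
      _ = C c₁ * strainPoly a := by rw [hT', map_add, h0, h2, zero_add]
  refine ⟨-2 * c₁, fun i => ?_⟩
  have hdT : ∀ j : Fin 3, pderiv j T = C c₁ * (C 2 * C (a j) * X j) := fun j => by
    rw [hT2, Derivation.leibniz, pderiv_C, smul_zero, add_zero, smul_eq_mul, pderiv_strainPoly a j]
  fin_cases i
  · simp only [Fin.zero_eta, Fin.isValue, eulerTopField_zero]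
    rw [hq0, hdT, hdT]
    simp only [map_mul, map_neg, map_ofNat, map_sub]
    ring
  · simp only [Fin.mk_one, Fin.isValue, eulerTopField_one]
    rw [hq1, hdT, hdT]
    simp only [map_mul, map_neg, map_ofNat, map_sub]
    ring
  · simp only [Fin.reduceFinMk, Fin.isValue, eulerTopField_two]
    rw [hq2, hdT, hdT]
    simp only [map_mul, map_neg, map_ofNat, map_sub]
    ring

end Summit.NavierStokesRegularity.NavierStokesRegularity.Theorems.PoloidalLiouville.CentreJet.HarmonicTangent

end
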